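import Mathlib.Order.Zorn
import Literature.Geometry.Lorentzian.OpensCausality
import Literature.Geometry.Lorentzian.CauchyDevelopmentRestrict
import Summits.FinalStateConjecture.FinalStateConjecture.Theorems.SwallowTheDatumSubdataDevelopmentsEmbedRigidity

/-!
# Route SwallowTheDatum · item `SubdataDevelopmentsEmbed` (stmt-FinalStateConjecture-10053) —
# the maximal common sub-development OVER A SUB-DATUM (Choquet-Bruhat–Geroch 1969, p. 333;
# Hawking–Ellis 1973, §7.6, p. 251; Sbierski 2016, §3.1, relative form)

Setting of the route decl
`Summit.FinalStateConjecture.FinalStateConjecture.Theses.SwallowTheDatum.SubdataDevelopmentsEmbed`: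
`𝒟'` is a Cauchy development of data `D₁` on `N` (in the item `D₁ = D.comap Φ`), `𝒟` a Cauchy
development of data `D₂` on `X`, and `Φ : N → X`. A **relative common sub-development** of `𝒟'`
and `𝒟` over `Φ` is an open connected `U ⊆ M'` containing `ι'(N)` in which `ι'(N)` is still a
Cauchy hypersurface (Sbierski 2016, Def. 2.4, the sub-development `(U ⊆ M', g'|_U, ι')`),
together with a map `ψ : M' → M` which ON `U` is smooth, isometric (`ψ^* g = g'`) and
time-orientation preserving, with `ψ ∘ ι' = ι ∘ Φ` (the relative form — `Φ` inserted — of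
"`M` is an extension of `(U, g'|_U, ι')`"; only the values of `ψ` on `U` matter). They are
preordered by EXTENSION: `U ≤ U'` and `ψ' = ψ` on `U`.

* `SubdataDevelopmentsEmbed.exists_maximal_relCGHD` — **if there is one relative common
  sub-development, there is a maximal one**: one admitting no proper extension. Proof as in
  Choquet-Bruhat–Geroch 1969, p. 333 / Hawking–Ellis 1973, p. 251 ("The set of all such common
  developments is likewise partially ordered and so again by Zorn's lemma there will be a maximal
  development"): a chain `(U_α, ψ_α)` is bounded by `(⋃ U_α, ψ)` with `ψ = ψ_α` on `U_α`
  (well defined along a chain) — open, connected, containing `ι'(N)`, with `ι'(N)` a Cauchy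
  hypersurface of the union (`IsCauchyHypersurface.iSup_opens`, Sbierski 2016, §3.1, second
  bullet of the existence proof of the MCGHD), and `ψ` smooth/isometric/orientation-preserving on
  the union because it agrees with `ψ_α` near every point of `U_α`; then Zorn
  (`exists_maximal_of_nonempty_chains_bounded`).
* `SubdataDevelopmentsEmbed.injOn_of_relCGHD` — on a relative common sub-development with
  injective `Φ`, `ψ` is INJECTIVE on `U` (the relative Lemma 3.2 of Sbierski,
  `injective_of_isIsometricImmersion_rel`, applied to the restricted Cauchy development
  `𝒟'.restrict U`; the displayed hypothesis `hν` — differentiability of the normal of `𝒟'` along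
  `ι'` — is the one of `CauchyDevelopment.restrict`).

What this leaves for the item (recorded, not vendored): (1) NONEMPTINESS of the family = relative
local geometric uniqueness (Choquet-Bruhat–Geroch 1969, Thm. 2; Hawking–Ellis 1973, §7.5); (2)
a maximal relative common sub-development has no corresponding boundary points (Sbierski 2016,
Thm. 3.5 = arXiv Thm. 12, relative form); (3) the glued spacetime `M ∪_ψ M'` is then a vacuum
Cauchy development of `D₂` extending `𝒟`, whence, for `𝒟` maximal, `U = M'` and `ψ` is the
embedding the item asks for. No definition is introduced (the predicate is displayed inline).
-/

noncomputable section

open Function Set Filter Topology TopologicalSpace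
open scoped Manifold ContDiff Topology

namespace Summit.FinalStateConjecture.FinalStateConjecture.Theorems

namespace SubdataDevelopmentsEmbed

open Literature.Geometry.Lorentzian

universe u v

variable {n : ℕ}
  {N : Type u} [TopologicalSpace N] [ChartedSpace (EuclideanSpace ℝ (Fin n)) N]
  [IsManifold (𝓡 n) ∞ N] [ConnectedSpace N] {D₁ : InitialDataSet (𝓡 n) N}
  {X : Type v} [TopologicalSpace X] [ChartedSpace (EuclideanSpace ℝ (Fin n)) X]
  [IsManifold (𝓡 n) ∞ X] [ConnectedSpace X] {D₂ : InitialDataSet (𝓡 n) X}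

/-- **Existence of a maximal relative common sub-development (Zorn).** Let `𝒟'`, `𝒟` be Cauchy
developments of data on `N` and on `X`, `Φ : N → X`. Call `(U, ψ)` — `U ⊆ M'` open, `ψ : M' → M` —
a relative common sub-development over `Φ` when: `ι'(N) ⊆ U`, `U` is connected, `ι'(N)` is a
Cauchy hypersurface of the open sub-spacetime `U`, and on `U` the map `ψ` is smooth, isometric and
time-orientation preserving, with `ψ ∘ ι' = ι ∘ Φ` (the seven displayed conjuncts). If one exists,
then one exists which is MAXIMAL: every relative common sub-development `(U', ψ')` with `U ≤ U'`
and `ψ' = ψ` on `U` has `U' = U`. Choquet-Bruhat–Geroch 1969, p. 333 and Hawking–Ellis 1973,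
§7.6, p. 251 (Zorn's lemma on common developments; chains are bounded by their union — here
`IsCauchyHypersurface.iSup_opens` for the Cauchy property of the union, Sbierski 2016, §3.1). -/
theorem exists_maximal_relCGHD (𝒟' : CauchyDevelopment D₁) (𝒟 : CauchyDevelopment D₂)
    (Φ : N → X)
    (h₀ : ∃ (U : Opens 𝒟'.carrier) (ψ : 𝒟'.carrier → 𝒟.carrier),
      (∀ u, 𝒟'.embed u ∈ U) ∧ IsConnected (U : Set 𝒟'.carrier) ∧
      (𝒟'.metric.restrict PseudoRiemannianMetric.contMDiff_restrict_holds U).IsCauchyHypersurface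
        (𝒟'.timeOrientation.restrict PseudoRiemannianMetric.contMDiff_restrict_holds
          𝒟'.timeOrientation.contMDiff_restrict_holds U) (Subtype.val ⁻¹' range 𝒟'.embed) ∧
      ContMDiffOn (𝓡 (n + 1)) (𝓡 (n + 1)) ∞ ψ U ∧
      (∀ p ∈ U, pullbackBilin (I := 𝓡 (n + 1)) (I' := 𝓡 (n + 1)) ψ 𝒟.metric.val p =
        𝒟'.metric.val p) ∧
      (∀ p ∈ U, 𝒟.timeOrientation.IsFutureDirected
        (mfderiv (𝓡 (n + 1)) (𝓡 (n + 1)) ψ p (𝒟'.timeOrientation.vectorField p))) ∧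
      ψ ∘ 𝒟'.embed = 𝒟.embed ∘ Φ) :
    ∃ (U : Opens 𝒟'.carrier) (ψ : 𝒟'.carrier → 𝒟.carrier),
      ((∀ u, 𝒟'.embed u ∈ U) ∧ IsConnected (U : Set 𝒟'.carrier) ∧
      (𝒟'.metric.restrict PseudoRiemannianMetric.contMDiff_restrict_holds U).IsCauchyHypersurface
        (𝒟'.timeOrientation.restrict PseudoRiemannianMetric.contMDiff_restrict_holds
          𝒟'.timeOrientation.contMDiff_restrict_holds U) (Subtype.val ⁻¹' range 𝒟'.embed) ∧
      ContMDiffOn (𝓡 (n + 1)) (𝓡 (n + 1)) ∞ ψ U ∧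
      (∀ p ∈ U, pullbackBilin (I := 𝓡 (n + 1)) (I' := 𝓡 (n + 1)) ψ 𝒟.metric.val p =
        𝒟'.metric.val p) ∧
      (∀ p ∈ U, 𝒟.timeOrientation.IsFutureDirected
        (mfderiv (𝓡 (n + 1)) (𝓡 (n + 1)) ψ p (𝒟'.timeOrientation.vectorField p))) ∧
      ψ ∘ 𝒟'.embed = 𝒟.embed ∘ Φ) ∧
      ∀ (U' : Opens 𝒟'.carrier) (ψ' : 𝒟'.carrier → 𝒟.carrier),
        ((∀ u, 𝒟'.embed u ∈ U') ∧ IsConnected (U' : Set 𝒟'.carrier) ∧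
        (𝒟'.metric.restrict PseudoRiemannianMetric.contMDiff_restrict_holds U').IsCauchyHypersurface
          (𝒟'.timeOrientation.restrict PseudoRiemannianMetric.contMDiff_restrict_holds
            𝒟'.timeOrientation.contMDiff_restrict_holds U') (Subtype.val ⁻¹' range 𝒟'.embed) ∧
        ContMDiffOn (𝓡 (n + 1)) (𝓡 (n + 1)) ∞ ψ' U' ∧
        (∀ p ∈ U', pullbackBilin (I := 𝓡 (n + 1)) (I' := 𝓡 (n + 1)) ψ' 𝒟.metric.val p =
          𝒟'.metric.val p) ∧
        (∀ p ∈ U', 𝒟.timeOrientation.IsFutureDirected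
          (mfderiv (𝓡 (n + 1)) (𝓡 (n + 1)) ψ' p (𝒟'.timeOrientation.vectorField p))) ∧
        ψ' ∘ 𝒟'.embed = 𝒟.embed ∘ Φ) →
        U ≤ U' → EqOn ψ ψ' U → U' = U := by
  classical
  -- abbreviate the predicate
  set P : Opens 𝒟'.carrier → (𝒟'.carrier → 𝒟.carrier) → Prop := fun U ψ ↦
    (∀ u, 𝒟'.embed u ∈ U) ∧ IsConnected (U : Set 𝒟'.carrier) ∧
      (𝒟'.metric.restrict PseudoRiemannianMetric.contMDiff_restrict_holds U).IsCauchyHypersurface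
        (𝒟'.timeOrientation.restrict PseudoRiemannianMetric.contMDiff_restrict_holds
          𝒟'.timeOrientation.contMDiff_restrict_holds U) (Subtype.val ⁻¹' range 𝒟'.embed) ∧
      ContMDiffOn (𝓡 (n + 1)) (𝓡 (n + 1)) ∞ ψ U ∧
      (∀ p ∈ U, pullbackBilin (I := 𝓡 (n + 1)) (I' := 𝓡 (n + 1)) ψ 𝒟.metric.val p =
        𝒟'.metric.val p) ∧
      (∀ p ∈ U, 𝒟.timeOrientation.IsFutureDirected
        (mfderiv (𝓡 (n + 1)) (𝓡 (n + 1)) ψ p (𝒟'.timeOrientation.vectorField p))) ∧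
      ψ ∘ 𝒟'.embed = 𝒟.embed ∘ Φ with hP
  change ∃ U ψ, P U ψ at h₀
  change ∃ U ψ, P U ψ ∧ ∀ U' ψ', P U' ψ' → U ≤ U' → EqOn ψ ψ' U → U' = U
  -- the relative common sub-developments, preordered by extension
  obtain ⟨U₀, ψ₀, hUψ₀⟩ := h₀
  let α := {x : Opens 𝒟'.carrier × (𝒟'.carrier → 𝒟.carrier) // P x.1 x.2}
  haveI : Nonempty α := ⟨⟨(U₀, ψ₀), hUψ₀⟩⟩
  let r : α → α → Prop := fun x y ↦ x.1.1 ≤ y.1.1 ∧ EqOn x.1.2 y.1.2 (x.1.1 : Set 𝒟'.carrier)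
  have htrans : ∀ {a b c : α}, r a b → r b c → r a c := fun hab hbc ↦
    ⟨hab.1.trans hbc.1, fun p hp ↦ (hab.2 hp).trans (hbc.2 (hab.1 hp))⟩
  -- every nonempty chain is bounded by its union
  have hchain : ∀ c : Set α, IsChain r c → c.Nonempty → ∃ ub, ∀ a ∈ c, r a ub := by
    intro c hc hne
    obtain ⟨x₀, hx₀⟩ := hne
    obtain ⟨u₀⟩ : Nonempty N := inferInstance
    let V : c → Opens 𝒟'.carrier := fun i ↦ i.1.1.1
    -- the glued map
    let ψs : 𝒟'.carrier → 𝒟.carrier := fun p ↦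
      if h : ∃ i : c, p ∈ V i then (h.choose : α).1.2 p else x₀.1.2 p
    -- it agrees with `ψ_i` on `V i` (chain comparability)
    have hagree : ∀ (i : c) (p : 𝒟'.carrier), p ∈ V i → ψs p = (i : α).1.2 p := by
      intro i p hp
      have h : ∃ j : c, p ∈ V j := ⟨i, hp⟩
      have hdef : ψs p = (h.choose : α).1.2 p := by simp only [ψs, dif_pos h]
      rw [hdef]
      by_cases hij : (h.choose : α) = (i : α)
      · rw [hij]
      · rcases hc h.choose.2 i.2 hij with hji | hij'
        · exact hji.2 h.choose_spec
        · exact (hij'.2 hp).symm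
    have hev : ∀ (i : c) (p : 𝒟'.carrier), p ∈ V i → ψs =ᶠ[𝓝 p] (i : α).1.2 := fun i p hp ↦
      Filter.eventuallyEq_of_mem ((V i).2.mem_nhds hp) fun q hq ↦ hagree i q hq
    have hmem : ∀ p : 𝒟'.carrier, p ∈ (⨆ i, V i : Opens 𝒟'.carrier) ↔ ∃ i, p ∈ V i := fun p ↦
      Opens.mem_iSup
    have hPs : P (⨆ i, V i) ψs := by
      refine ⟨?_, ?_, ?_, ?_, ?_, ?_, ?_⟩
      · -- `ι'(N) ⊆ ⋃ V i`
        intro u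
        exact (hmem _).2 ⟨⟨x₀, hx₀⟩, x₀.2.1 u⟩
      · -- connected: connected members with the common point `ι' u₀`
        refine ⟨⟨𝒟'.embed u₀, (hmem _).2 ⟨⟨x₀, hx₀⟩, x₀.2.1 u₀⟩⟩, ?_⟩
        rw [Opens.coe_iSup]
        exact isPreconnected_iUnion ⟨𝒟'.embed u₀, mem_iInter.2 fun i ↦ (i : α).2.1 u₀⟩
          fun i ↦ (i : α).2.2.1.isPreconnected
      · -- `ι'(N)` is a Cauchy hypersurface of the union
        exact LorentzianMetric.IsCauchyHypersurface.iSup_opens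
          PseudoRiemannianMetric.contMDiff_restrict_holds
          𝒟'.timeOrientation.contMDiff_restrict_holds (WithTop.coe_le_coe.mpr le_top)
          𝒟'.isCauchyHypersurface V fun i ↦ (i : α).2.2.2.1
      · -- smooth on the union
        intro p hp
        obtain ⟨i, hpi⟩ := (hmem p).1 hp
        have h1 : ContMDiffAt (𝓡 (n + 1)) (𝓡 (n + 1)) ∞ (i : α).1.2 p :=
          ((i : α).2.2.2.2.1 p hpi).contMDiffAt ((V i).2.mem_nhds hpi)
        exact (h1.congr_of_eventuallyEq (hev i p hpi)).contMDiffWithinAt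
      · -- isometric on the union
        intro p hp
        obtain ⟨i, hpi⟩ := (hmem p).1 hp
        have hd : mfderiv (𝓡 (n + 1)) (𝓡 (n + 1)) ψs p =
            mfderiv (𝓡 (n + 1)) (𝓡 (n + 1)) (i : α).1.2 p := (hev i p hpi).mfderiv_eq
        have hv : ψs p = (i : α).1.2 p := hagree i p hpi
        ext v w
        have hk' := congrArg (fun b ↦ b v w) ((i : α).2.2.2.2.2.1 p hpi)
        simp only [pullbackBilin_apply] at hk' ⊢
        rw [hd, hv]
        exact hk'
      · -- time-orientation preserving on the union
        intro p hp
        obtain ⟨i, hpi⟩ := (hmem p).1 hp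
        have hd : mfderiv (𝓡 (n + 1)) (𝓡 (n + 1)) ψs p =
            mfderiv (𝓡 (n + 1)) (𝓡 (n + 1)) (i : α).1.2 p := (hev i p hpi).mfderiv_eq
        have hv : ψs p = (i : α).1.2 p := hagree i p hpi
        show 𝒟.timeOrientation.IsFutureDirected
          (mfderiv (𝓡 (n + 1)) (𝓡 (n + 1)) ψs p (𝒟'.timeOrientation.vectorField p))
        rw [hd, hv]
        exact (i : α).2.2.2.2.2.2.1 p hpi
      · -- `ψ ∘ ι' = ι ∘ Φ`
        funext u
        show ψs (𝒟'.embed u) = 𝒟.embed (Φ u)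
        rw [hagree ⟨x₀, hx₀⟩ (𝒟'.embed u) (x₀.2.1 u)]
        exact congrFun x₀.2.2.2.2.2.2.2 u
    refine ⟨⟨(⨆ i, V i, ψs), hPs⟩, fun a ha ↦ ⟨?_, ?_⟩⟩
    · -- `a ≤ union`
      exact le_iSup V ⟨a, ha⟩
    · exact fun p hp ↦ (hagree ⟨a, ha⟩ p hp).symm
  -- Zorn
  obtain ⟨m, hm⟩ := exists_maximal_of_nonempty_chains_bounded hchain htrans
  refine ⟨m.1.1, m.1.2, m.2, fun U' ψ' hP hle heq ↦ ?_⟩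
  exact le_antisymm (hm ⟨(U', ψ'), hP⟩ ⟨hle, heq⟩).1 hle

/-- **On a relative common sub-development over an injective `Φ`, `ψ` is injective.** With
`𝒟'`, `𝒟`, `Φ` as above, let `U ⊆ M'` be open and connected with `ι'(N) ⊆ U` and `ι'(N)` a
Cauchy hypersurface of the sub-spacetime `U`, and let `ψ : M' → M` be smooth, isometric and
time-orientation preserving on `U` with `ψ ∘ ι' = ι ∘ Φ`, `Φ` injective. Then `ψ` is injective on
`U`: the restriction `(U, g'|_U, τ'|_U, ι', ν')` is a Cauchy development of `D₁`
(`CauchyDevelopment.restrict`, hypothesis `hν`: the normal of `𝒟'` is differentiable along `ι'`)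
and `ψ|_U` is a time-orientation preserving isometric immersion of it into `𝒟` over `Φ`, hence
injective (`injective_of_isIsometricImmersion_rel`, the relative Lemma 3.2 of Sbierski 2016). -/
theorem injOn_of_relCGHD (𝒟' : CauchyDevelopment D₁) (𝒟 : CauchyDevelopment D₂) {Φ : N → X}
    (hΦ : Injective Φ)
    (hν : ∀ x, MDifferentiableAt (𝓡 n) (𝓡 (n + 1)).tangent
      (fun x ↦ (Bundle.TotalSpace.mk' (EuclideanSpace ℝ (Fin (n + 1))) (𝒟'.embed x)
        (𝒟'.normal x) : TangentBundle (𝓡 (n + 1)) 𝒟'.carrier)) x)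
    {U : Opens 𝒟'.carrier} {ψ : 𝒟'.carrier → 𝒟.carrier}
    (hι : ∀ u, 𝒟'.embed u ∈ U) (hU : IsConnected (U : Set 𝒟'.carrier))
    (hC : (𝒟'.metric.restrict PseudoRiemannianMetric.contMDiff_restrict_holds U).IsCauchyHypersurface
        (𝒟'.timeOrientation.restrict PseudoRiemannianMetric.contMDiff_restrict_holds
          𝒟'.timeOrientation.contMDiff_restrict_holds U) (Subtype.val ⁻¹' range 𝒟'.embed))
    (hs : ContMDiffOn (𝓡 (n + 1)) (𝓡 (n + 1)) ∞ ψ U)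
    (hi : ∀ p ∈ U, pullbackBilin (I := 𝓡 (n + 1)) (I' := 𝓡 (n + 1)) ψ 𝒟.metric.val p =
        𝒟'.metric.val p)
    (ht : ∀ p ∈ U, 𝒟.timeOrientation.IsFutureDirected
        (mfderiv (𝓡 (n + 1)) (𝓡 (n + 1)) ψ p (𝒟'.timeOrientation.vectorField p)))
    (hc : ψ ∘ 𝒟'.embed = 𝒟.embed ∘ Φ) : InjOn ψ U := by
  -- the Cauchy hypersurface of the restriction, in the form `restrict` wants
  have hrange : range (𝒟'.embedOpens U hι) = Subtype.val ⁻¹' range 𝒟'.embed := by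
    ext p
    constructor
    · rintro ⟨u, rfl⟩; exact ⟨u, rfl⟩
    · rintro ⟨u, hu⟩; exact ⟨u, Subtype.ext hu⟩
  have hC' : (𝒟'.metric.restrict PseudoRiemannianMetric.contMDiff_restrict_holds U).IsCauchyHypersurface
      (𝒟'.timeOrientation.restrict PseudoRiemannianMetric.contMDiff_restrict_holds
        𝒟'.timeOrientation.contMDiff_restrict_holds U) (range (𝒟'.embedOpens U hι)) := by
    rw [hrange]; exact hC
  -- `ψ ∘ Subtype.val` is a t.o.p. isometric immersion of the restriction into `𝒟` over `Φ`
  have hsmooth : ContMDiff (𝓡 (n + 1)) (𝓡 (n + 1)) ∞ (ψ ∘ (Subtype.val : U → 𝒟'.carrier)) :=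
    hs.comp_contMDiff contMDiff_subtype_val fun p ↦ p.2
  have hmf : ∀ (y : U) (v : TangentSpace (𝓡 (n + 1)) y),
      mfderiv (𝓡 (n + 1)) (𝓡 (n + 1)) (ψ ∘ (Subtype.val : U → 𝒟'.carrier)) y v =
        mfderiv (𝓡 (n + 1)) (𝓡 (n + 1)) ψ y.1 v := by
    intro y v
    have hd : MDifferentiableAt (𝓡 (n + 1)) (𝓡 (n + 1)) ψ y.1 :=
      ((hs y.1 y.2).contMDiffAt (U.2.mem_nhds y.2)).mdifferentiableAt (by simp)
    rw [mfderiv_comp y hd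
      (hasMFDerivAt_subtypeVal (I' := 𝓡 (n + 1)) (W := U) y).mdifferentiableAt, mfderiv_subtypeVal]
    rfl
  have hiso : (𝒟'.restrict U hU hι hν hC').metric.IsIsometricImmersion
      𝒟.metric.toPseudoRiemannianMetric (ψ ∘ (Subtype.val : U → 𝒟'.carrier)) := by
    refine ⟨hsmooth, fun (y : U) ↦ ?_⟩
    ext v w
    have hk := congrArg (fun b ↦ b v w) (hi y.1 y.2)
    simp only [pullbackBilin_apply] at hk
    change 𝒟.metric.val (ψ y.1)
        (mfderiv (𝓡 (n + 1)) (𝓡 (n + 1)) (ψ ∘ (Subtype.val : U → 𝒟'.carrier)) y v)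
        (mfderiv (𝓡 (n + 1)) (𝓡 (n + 1)) (ψ ∘ (Subtype.val : U → 𝒟'.carrier)) y w) =
      𝒟'.metric.val y.1 v w
    have e1 := hmf y v
    have e2 := hmf y w
    rw [e1, e2]
    exact hk
  have hinj : Injective (ψ ∘ (Subtype.val : U → 𝒟'.carrier)) := by
    refine injective_of_isIsometricImmersion_rel (𝒟'.restrict U hU hι hν hC') 𝒟 hiso
      (fun y ↦ ?_) hΦ ?_
    · -- time orientation: `d(ψ ∘ val) T'|_U = dψ T'` is future-directed
      change 𝒟.timeOrientation.IsFutureDirected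
        (mfderiv (𝓡 (n + 1)) (𝓡 (n + 1)) (ψ ∘ (Subtype.val : U → 𝒟'.carrier)) y
          (𝒟'.timeOrientation.vectorField y.1))
      rw [hmf]
      exact ht y.1 y.2
    · -- `(ψ ∘ val) ∘ ι'_U = ψ ∘ ι' = ι ∘ Φ`
      exact hc
  intro p hp q hq hpq
  exact congrArg Subtype.val (@hinj ⟨p, hp⟩ ⟨q, hq⟩ hpq)

end SubdataDevelopmentsEmbed

end Summit.FinalStateConjecture.FinalStateConjecture.Theorems

end
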